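import Summits.BirchSwinnertonDyer.BirchSwinnertonDyer.Theorems.ByReductionTypeAtTwoSupersingularFlatBlindPinchOfAvatar
import Literature.NumberTheory.EllipticCurves.Rank1Residual.Typed.Basic
import HarnessLib

/-!
# W-92 / D-imc-91 (-imc g36, planner-of-record F1Sign2, LENS Iwasawa main conjecture) — the `Ш_an`-UNIT ESCAPE
# for stub 5/5 `stub_lowerOffGenericOdd : LowerBoundOffGenericOddAtTwo` of the registered line
# `Lines/odd_blind_package.lean` v2.17 (crux 19097 `SupersingularRankZeroAtTwo`)

CRUX WORKFILE (text/bytes for the LEAD ss-1 and the pen; no registry touch, no proposal; `sorry`-free).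

## What it says
Miller's LOWER half `MissingLowerBoundAt W 2 := ∃ q, shaAn W = q ∧ v₂ q ≤ v₂ #Ш(E)` (`Typed/Basic.lean:60`) is FREE
whenever `v₂ #Ш_an(E) ≤ 0` (`0 ≤ v₂ #Ш` always): tree door
`Summit.BirchSwinnertonDyer.BirchSwinnertonDyer.Theorems.bsdp_of_missingUpperBoundAt_of_shaAn_le` (`PrintX6UnitValue.lean`, b2b X6
cell; the same three lines as `ClassRecordThreeCornerTwistWitnessExactTwin.missingLowerBoundAt_of_shaAn_unit`,
`Cruxes/BSDpOnCellC/Lines/twistunit.lean:386`).  The registry kernel `SupersingularRankZeroAtTwo_of` (v2.17 :2113) already holds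
the UPPER half `hU : MissingUpperBoundAt W 2` for EVERY habitat curve from stubs 1–3
(`SSFlatRoad.missingUpperBoundAt_two_of_uniformFlat_of_fineMu`), and in its third branch asks stub 5/5 for the lower half on
every row off the generic-odd locus and off the twist-pinch locus — INCLUDING the rows with `2 ∤ #Ш_an`, where nothing is
missing.  §2 below re-types stub 5/5 with ONE MORE HYPOTHESIS «`∀ q, shaAn W = q → 1 ≤ v₂ q`» (a WEAKENING, exactly as W-88
added the no-pinch hypothesis), §3 is the kernel's third branch with the escape wired (`by_cases` on the unit locus), §1 the
door in the crux's currency.  PRINT: Miller 2011 §1 / Def. 1.1 («when `#Ш_an = 1` only the upper bound is needed»),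
Grigorov–Jorza–Patrikis–Stein–Tarniţă 2009 §1; novelty NIL — this is bookkeeping the registry has not wired.

## What it changes (census D-imc-91, `HOME/MEMO-imc-data/g36/r91/R91-shaunit.txt`, Cremona `allbsd`, habitat = rank 0,
## `2 ∤ N`, `a₂` even, non-CM; classes = curve #1; `v₂ #Ш_an` is a class invariant on the habitat)
* FULL RANGE `N < 5·10⁵`: 69 850 habitat classes (335 CM classes excluded).  EVEN half (`χ₈(N) = +1`): 29 292 classes,
  `#Ш_an` odd on 26 152 (89.3 %), `v₂ = 2` on 2 869, `v₂ ≥ 4` on 271.  ODD half: 40 558 = 35 981 + 4 091 + 486.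
  The cell's PARTITION unit X5@2-ss = `{2⁴ ∣ #Ш_an}` = 271 + 486 = 757 classes EXACTLY (LEAD ss-1 GEN 24 SCOPE memo §1(e):
  the unit locus is VACUOUS on X5 — confirmed; this escape closes NO X5 class and moves no PARTITION number).
* REGISTRY CENSUS RANGE `N < 7813` (C-imc-76 categories): generic odd 859 classes (838 unit + 20 with `#Ш_an = 4` + 1309a1
  with `2⁴ ∣ #Ш_an` — the ONLY X5-ss class below 7813); EVEN `r_an(E^{(2)}) = 0`: 301 = 285 unit + 16 with `#Ш_an = 4`;
  EVEN `r_an(E^{(2)}) = 2` = the named residual R-imc-76: **117/117 on the unit locus**; deep odd: 0.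
  ⟹ after W-92 the population of stub 5/5 below 7813 is **16 classes**, all `{even half, r_an(E^{(2)}) = 0, #Ш_an = 4}`:
  1849d1 2265a1 2409b1 3575e1 3975b1 4655g1 4975c1 6057a1 6071b1 6175b1 6201c1 6705c1 6831f1 6921b1 7359a1 7719c1 —
  exactly the rows where the ♯-package / (C₋₂) blind certificate of the RANK-0 twist is the relevant road (SCOPE memo §1(b)),
  and R-imc-76 needs NO lower-half input at all: on its 117 classes `BSD₂(E)` is stubs 1–3 (Kato side) + this door.
* HONEST COROLLARY ABOUT -imc's OWN PINCH (W-88 / D-imc-87 / D-imc-90): on the habitat the twist-pinch locus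
  (`μ(G) = 0 ∧ λ(G) ≤ 1 ∧ corank Sel_{2^∞}(E^{(2)}) ≥ 2`) lies INSIDE the unit locus — K87-C + K90-Λ give `v₂ G(0) = 1`, i.e.
  `v₂(L(E,1)/Ω_E) = 1` (`c♭`, `ϖ` 2-adic units), and the even-half Tamagawa law (tree, `TamParityChi8Link` /
  `PlusSymbolParityTwo.two_dvd_tamagawaProduct_of_sign`) gives `2 ∣ ∏c_p`, so `v₂ #Ш_an = 1 − v₂ ∏c_p ≤ 0`; census: the 91
  pinch-certifiable classes ⊂ the 117 ⊂ the unit locus.  For the purpose of `BSDp W 2` the pinch branch is therefore SUBSUMED by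
  W-92; what the pinch keeps is its MAIN-CONJECTURE content (`λ(char X♭) = λ(G) = 1`, `(char X♭) = (G)` up to `μ`), which BSD₂
  does not need.  The LEAD may keep both branches (the pinch costs nothing and records the MC instance) or drop the pinch for
  count hygiene — planner's recommendation: keep W-88, add W-92 in v2.19, re-word the R-imc-76 paragraph of stub 5's docstring.

## LENS verdict refined (MEMO-imc §10.125 T7)
The LOWER-half error term at 2 (T7) lives on `{2 ∣ #Ш_an}` only (≈ 10.7 % of the even half, 11.3 % of the odd half); on the
unit locus the whole of `BSD₂` in analytic rank 0 at a supersingular 2 is KATO-SIDE (stubs 1–3: Kato's divisibility at 2, the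
CK♭ package, `μ = 0`).  On X5 (`2⁴ ∣ #Ш_an`) both halves are substantive and no per-row escape of this cell applies.

HONEST: nothing here is a theorem about the crux beyond bookkeeping; 19097 stays OPEN on 5 stubs; BSD is proved for no curve;
PARTITION unchanged.
-/

set_option autoImplicit false
set_option linter.dupNamespace false

noncomputable section

open scoped Classical MatrixGroups ModularForm NumberField
open NumberField IsDedekindDomain CongruenceSubgroup WeierstrassCurve PowerSeries
open Literature.NumberTheory.EllipticCurves Literature.NumberTheory.EllipticCurves.IwasawaDual
  Literature.NumberTheory.EllipticCurves.Sprung2012 Literature.NumberTheory.EllipticCurves.Sprung2017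
  Literature.NumberTheory.EllipticCurves.ModularForms
  Literature.NumberTheory.EllipticCurves.Rank1Residual Literature.NumberTheory.EllipticCurves.Rank1Residual.Typed
  Literature.NumberTheory.EllipticCurves.Kobayashi2003 Literature.NumberTheory.GaloisRepresentations ZpExtension
open Summit.BirchSwinnertonDyer.Rank1Residual Summit.BirchSwinnertonDyer.Rank1Residual.Supersingular
  Summit.BirchSwinnertonDyer.Rank1Residual.X5.O1 Summit.BirchSwinnertonDyer.Rank1Residual.X1.MuLambda

namespace Summit.BirchSwinnertonDyer.BirchSwinnertonDyer.Cruxes.SupersingularRankZeroAtTwo.W92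

/-! ## §1 The door in the crux's currency -/

/-- **The trivial lower half.** `v₂ #Ш_an ≤ 0 ⟹ MissingLowerBoundAt W 2` (`0 ≤ v₂ #Ш`).  Bookkeeping; tree twins:
`Theorems.missingPPartAt_of_missingUpperBoundAt_of_shaAn_le`, `ClassRecordThreeCornerTwistWitnessExactTwin.missingLowerBoundAt_of_shaAn_unit`.
[cite: Miller2011LMS, Def. 1.1 (arXiv:1010.2431 p. 3)] -/
theorem missingLowerBoundAt_two_of_shaAn_le (W : WeierstrassCurve ℚ)
    (hsha : ∃ q : ℚ, shaAn W = (q : ℂ) ∧ padicValRat 2 q ≤ 0) : MissingLowerBoundAt W 2 := by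
  obtain ⟨q, hq, hle⟩ := hsha
  exact ⟨q, hq, hle.trans (by exact_mod_cast Nat.zero_le _)⟩

/-- **`BSD₂` on the unit locus from the UPPER half alone**, analytic rank `0`: GZK (`hGZK`) + `MissingUpperBoundAt W 2`
(in the registry: stubs 1–3 via `SSFlatRoad.missingUpperBoundAt_two_of_uniformFlat_of_fineMu`) + `v₂ #Ш_an ≤ 0`.
Same proof as `Theorems.bsdp_of_missingUpperBoundAt_of_shaAn_le` (not imported here to keep the closure that of the pinch file).
[cite: Miller2011LMS, §1 and Def. 1.1 (arXiv:1010.2431 p. 3)] -/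
theorem bsdp_two_of_upper_of_shaAn_le (hGZK : rank_eq_analyticRank_of_analyticRank_le_one)
    (W : WeierstrassCurve ℚ) [W.IsElliptic] (hr : W.analyticRank = 0)
    (hU : MissingUpperBoundAt W 2) (hsha : ∃ q : ℚ, shaAn W = (q : ℂ) ∧ padicValRat 2 q ≤ 0) : BSDp W 2 := by
  haveI : Fact (Nat.Prime 2) := ⟨Nat.prime_two⟩
  exact bsdp_of_missingPPartAt W 2 hGZK (by omega)
    (missingPPartAt_of_lower_of_upper W 2 (missingLowerBoundAt_two_of_shaAn_le W hsha) hU)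

/-! ## §2 Stub 5/5 re-typed with the unit-locus escape (a WEAKENING of v2.17's statement) -/

/-- VERBATIM copy of the registry's v2.17 `LowerBoundOffGenericOddAtTwo` (`Lines/odd_blind_package.lean` :1712; restated here only
because a scratch file cannot import a `Cruxes` module): Miller's lower half off the generic-odd locus and off the twist-pinch locus.
[cite: Miller2011LMS, Def. 1.1] [cite: Sprung2017, Cor. 4.11] -/
@[conjecture] def LowerBoundOffGenericOddAtTwo : Prop :=
  ∀ (W : WeierstrassCurve ℚ) [W.IsElliptic] [W.IsGloballyMinimal],
    ¬ W.HasCM → W.analyticRank = 0 → GoodSS W 2 →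
    (W.rootNumber * ZMod.χ₈ (W.conductorNorm ℤ : ZMod 8) = -1 →
      ∀ (W₂ : WeierstrassCurve ℚ) [W₂.IsElliptic] [W₂.IsGloballyMinimal],
        (∃ C : WeierstrassCurve.VariableChange ℚ, C • W.quadraticTwist 2 = W₂) → W₂.analyticRank ≠ 1) →
    (∀ [NeZero (W.conductorNorm ℤ)] (f : CuspForm (Gamma0 (W.conductorNorm ℤ)) 2), IsNewformOf W f →
      ∀ (ϖ : ℚ), (ϖ : ℝ) * W.realPeriodRat = plusPeriod f →
      ∀ (Ls Lf : IwasawaAlgebra 2), IsSprungPair f 2 (W.frobeniusTrace 2) Ls Lf →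
      ∀ (G : IwasawaAlgebra 2), iwasawaToPowerSeries 2 G = PowerSeries.C (ϖ : ℚ_[2]) * iwasawaToPowerSeries 2 Lf →
        Summit.BirchSwinnertonDyer.Rank1Residual.X1.MuLambda.mu G = 0 →
        Summit.BirchSwinnertonDyer.Rank1Residual.X1.MuLambda.lam G ≤ 1 →
      ∀ (W₂ : WeierstrassCurve ℚ) [W₂.IsElliptic],
        (∃ C : WeierstrassCurve.VariableChange ℚ, C • W.quadraticTwist 2 = W₂) → W₂.selmerCorank 2 ≤ 1) →
    MissingLowerBoundAt W 2

/-- **Stub 5/5, v2.19 candidate (W-92): Miller's lower half off the generic-odd locus, off the twist-pinch locus, AND OFF THE UNIT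
LOCUS** — one more curried escape clause «`#Ш_an` is a rational of positive 2-adic valuation» (`∀ q, shaAn W = q → 1 ≤ v₂ q`); on
the unit locus the kernel closes `BSDp W 2` from stubs 1–3 alone (§3).  A WEAKENING of v2.17's statement (one more hypothesis,
`lowerBoundOffGenericOddOffUnitAtTwo_of`).  Census D-imc-91: below 7813 its population is 16 classes (even half, `r_an(E^{(2)}) = 0`,
`#Ш_an = 4`); full range: the `2 ∣ #Ш_an` rows of the even half (3 140 classes) and of the deep-odd set.
[cite: Miller2011LMS, Def. 1.1 (arXiv:1010.2431 p. 3)] [cite: Sprung2017, Cor. 4.11] -/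
@[conjecture] def LowerBoundOffGenericOddOffUnitAtTwo : Prop :=
  ∀ (W : WeierstrassCurve ℚ) [W.IsElliptic] [W.IsGloballyMinimal],
    ¬ W.HasCM → W.analyticRank = 0 → GoodSS W 2 →
    (W.rootNumber * ZMod.χ₈ (W.conductorNorm ℤ : ZMod 8) = -1 →
      ∀ (W₂ : WeierstrassCurve ℚ) [W₂.IsElliptic] [W₂.IsGloballyMinimal],
        (∃ C : WeierstrassCurve.VariableChange ℚ, C • W.quadraticTwist 2 = W₂) → W₂.analyticRank ≠ 1) →
    (∀ [NeZero (W.conductorNorm ℤ)] (f : CuspForm (Gamma0 (W.conductorNorm ℤ)) 2), IsNewformOf W f →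
      ∀ (ϖ : ℚ), (ϖ : ℝ) * W.realPeriodRat = plusPeriod f →
      ∀ (Ls Lf : IwasawaAlgebra 2), IsSprungPair f 2 (W.frobeniusTrace 2) Ls Lf →
      ∀ (G : IwasawaAlgebra 2), iwasawaToPowerSeries 2 G = PowerSeries.C (ϖ : ℚ_[2]) * iwasawaToPowerSeries 2 Lf →
        Summit.BirchSwinnertonDyer.Rank1Residual.X1.MuLambda.mu G = 0 →
        Summit.BirchSwinnertonDyer.Rank1Residual.X1.MuLambda.lam G ≤ 1 →
      ∀ (W₂ : WeierstrassCurve ℚ) [W₂.IsElliptic],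
        (∃ C : WeierstrassCurve.VariableChange ℚ, C • W.quadraticTwist 2 = W₂) → W₂.selmerCorank 2 ≤ 1) →
    (∀ q : ℚ, shaAn W = (q : ℂ) → 1 ≤ padicValRat 2 q) →
    MissingLowerBoundAt W 2

/-- The re-typed stub is WEAKER than v2.17's (one more hypothesis). Bookkeeping. [cite: Miller2011LMS, Def. 1.1] -/
theorem lowerBoundOffGenericOddOffUnitAtTwo_of (h : LowerBoundOffGenericOddAtTwo) :
    LowerBoundOffGenericOddOffUnitAtTwo := by
  intro W _ _ hCM hr hss hgen hpinch _
  exact h W hCM hr hss hgen hpinch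

/-! ## §3 The kernel's third branch with the escape wired (replay of `SupersingularRankZeroAtTwo_of` :2113, last `·` block) -/

/-- **Third branch of the kernel, v2.19 shape.** Off the generic-odd locus (`hgen`) and off the twist-pinch locus (`hpinch`), with
the UPPER half `hU` in hand (stubs 1–3): EITHER `#Ш_an` is a rational of valuation `≤ 0` — then `BSDp W 2` by §1, no stub 5 —
OR stub 5/5 (re-typed, `h5`) supplies the lower half.  `sorry`-free; the registry version replaces `h5` by `stub_lowerOffGenericOdd`.
[cite: Miller2011LMS, §1 and Def. 1.1 (arXiv:1010.2431 p. 3)] -/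
theorem bsdp_two_thirdBranch_of_offUnitStub (hGZK : rank_eq_analyticRank_of_analyticRank_le_one)
    (h5 : LowerBoundOffGenericOddOffUnitAtTwo)
    (W : WeierstrassCurve ℚ) [W.IsElliptic] [W.IsGloballyMinimal]
    (hCM : ¬ W.HasCM) (hr : W.analyticRank = 0) (hss : GoodSS W 2)
    (hU : MissingUpperBoundAt W 2)
    (hgen : W.rootNumber * ZMod.χ₈ (W.conductorNorm ℤ : ZMod 8) = -1 →
      ∀ (W₂ : WeierstrassCurve ℚ) [W₂.IsElliptic] [W₂.IsGloballyMinimal],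
        (∃ C : WeierstrassCurve.VariableChange ℚ, C • W.quadraticTwist 2 = W₂) → W₂.analyticRank ≠ 1)
    (hpinch : ∀ [NeZero (W.conductorNorm ℤ)] (f : CuspForm (Gamma0 (W.conductorNorm ℤ)) 2), IsNewformOf W f →
      ∀ (ϖ : ℚ), (ϖ : ℝ) * W.realPeriodRat = plusPeriod f →
      ∀ (Ls Lf : IwasawaAlgebra 2), IsSprungPair f 2 (W.frobeniusTrace 2) Ls Lf →
      ∀ (G : IwasawaAlgebra 2), iwasawaToPowerSeries 2 G = PowerSeries.C (ϖ : ℚ_[2]) * iwasawaToPowerSeries 2 Lf →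
        Summit.BirchSwinnertonDyer.Rank1Residual.X1.MuLambda.mu G = 0 →
        Summit.BirchSwinnertonDyer.Rank1Residual.X1.MuLambda.lam G ≤ 1 →
      ∀ (W₂ : WeierstrassCurve ℚ) [W₂.IsElliptic],
        (∃ C : WeierstrassCurve.VariableChange ℚ, C • W.quadraticTwist 2 = W₂) → W₂.selmerCorank 2 ≤ 1) :
    BSDp W 2 := by
  haveI : Fact (Nat.Prime 2) := ⟨Nat.prime_two⟩
  by_cases hsha : ∃ q : ℚ, shaAn W = (q : ℂ) ∧ padicValRat 2 q ≤ 0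
  · exact bsdp_two_of_upper_of_shaAn_le hGZK W hr hU hsha
  · have hL : MissingLowerBoundAt W 2 := by
      refine h5 W hCM hr hss hgen hpinch ?_
      intro q hq
      by_contra hlt
      exact hsha ⟨q, hq, by omega⟩
    exact bsdp_of_missingPPartAt W 2 hGZK (by omega) (missingPPartAt_of_lower_of_upper W 2 hL hU)

/-! ## §4 Sanity: on the unit locus the re-typed stub is discharged outright (what the escape buys, stated positively) -/

/-- On a curve with `#Ш_an` a rational of valuation `≤ 0` the conclusion of stub 5 holds with NO input: the unit-locus rows never
reach `stub_lowerOffGenericOdd` in the v2.19 kernel, and if they did they would be free.  Bookkeeping. [cite: Miller2011LMS, Def. 1.1] -/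
theorem missingLowerBoundAt_two_unitRow (W : WeierstrassCurve ℚ) {q : ℚ} (hq : shaAn W = (q : ℂ))
    (hv : padicValRat 2 q ≤ 0) : MissingLowerBoundAt W 2 :=
  missingLowerBoundAt_two_of_shaAn_le W ⟨q, hq, hv⟩

end Summit.BirchSwinnertonDyer.BirchSwinnertonDyer.Cruxes.SupersingularRankZeroAtTwo.W92

end
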